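import Summits.NavierStokesRegularity.TurbBounds.TailN1G2Glue
import Summits.NavierStokesRegularity.TurbBounds.Certs.N1G2.Evaluator
import Summits.NavierStokesRegularity.TurbBounds.RBDensity
import Literature.Analysis.SpecialFunctions.LegendreNikolskii
import HarnessLib

/-!
# Row RB-N1 (CERTIFIED.md RB-N1: Ra = 10000, horizontal period Γ = 2, degree-6 Legendre background): the Legendre TAIL LEMMA for `(N, P) = (16, 6)`
# and the FULL-GAP positivity of the mode form AT THE LATTICE WAVENUMBERS `K = k_m² = (2π·m/2)²`, `1 ≤ m ≤ 8`, PROVED from the finite lattice certificate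
# `Certs.N1G2.Evaluator.certificate`, plus the cutoff `Certs.N1G2.Evaluator.cutoff` (every `K ≥ K_c = K2_9`)
(cell `pub-turb` / `turb-bounds`; v2 — fixed-period RB rows; written by pub-turb-cert, prover-pub-turb-cert-g8-0 (`code/make_tail_lat.py N1G2`, the pattern of this
generation's hand-written `N1G2Tail.lean` = gen 7's `Results/N1primeTail.lean` with the interval cover replaced by the lattice).)

HONEST FRAMING: rigorous bounds for the stated PDE and boundary conditions; no claim about physical turbulence beyond the bound.
KERNEL-CHECKED here (standard axioms, no `sorry`, no `native_decide`): with the RB-type form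
`rbForm a0 s g K [W, Θ] = ∫_{-1}^{1} a0(16W″²/K + 8W′² + KW²) + s(4Θ′² + KΘ²) + 2·g·W·Θ dx`, `g = Σ_{p≤6} ĝ_p P_p` (`ĝ₀ = −s`, `ĝ_p = φ̂_p`), `a0 = (s−1)/Ra`:
* `rbForm_nonneg_of_mode`: for every lattice mode `1 ≤ m ≤ 8` the form at `K = (2π·m/2)²` is `≥ 0` on the two-sided class `W(±1) = W′(±1) = 0`, `Θ(±1) = 0` —
  from `Certs.N1G2.Evaluator.certificate` (8 LMIs of dimension 46 at rbsdp's rational lattice data, transferred to the irrational datum by `TurbBounds/RBLattice`)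
  through the tail lemma proved here — generic `(N, P) = (16, 6)` lower bound `TailPolyGenW.rbForm_poly_lower_bound`, the bridge `TailN1G2.finGenW_eq_quadForm`
  (literal projected rule = tracked finite part on the kept coordinates, far-wall conditions `c₀ = c₁ = d₀ = 0` from `TailTwoSided.legCoeff_farWall_*`),
  PSD + the two slack lines, and the two-sided density `RBDensity.rbForm_nonneg_of_poly2`;
* `rbForm_nonneg_beyond_cutoff`: for every `K ≥ K_c = 4·PI_LO²·9²/Γ²` (≤ `k_9²`) the form is `≥ 0` for ALL fields — `Certs.N1G2.Evaluator.cutoff` via `TailTwoSided.rbForm_nonneg_of_cutoff`.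
`Results/N1G2Spectral.lean` turns these (via gen 6's `RBSpectralLink`) into the premises of pub-turb-sos's lattice interface `SpectralForm.spectralConstraintOn_periodLattice2_of_cutoff`.
NOT CLAIMED: anything about the Boussinesq reduction itself; other periods; no physics.
-/

set_option linter.style.longLine false

noncomputable section

namespace Summit.NavierStokesRegularity.TurbBounds.TailN1G2

open Polynomial intervalIntegral MeasureTheory Finset Matrix Set Literature.Analysis.SpecialFunctions
open Summit.NavierStokesRegularity.TurbBounds.LadderTail (w IsLadder phi lam w_pos lam_pos)
open Summit.NavierStokesRegularity.TurbBounds.LegendreCoeffs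
open Summit.NavierStokesRegularity.TurbBounds.CouplingSplit (pairWeight couplingExact)
open Summit.NavierStokesRegularity.TurbBounds.TailPolyGenW (rbForm finGenW rbForm_poly_lower_bound)
open Summit.NavierStokesRegularity.TurbBounds.TailTwoSided
open Summit.NavierStokesRegularity.TurbBounds.Certs.N1G2.Evaluator (Ra a0 s T ghat0 ghat1 ghat2 ghat3 ghat4 ghat5 ghat6 lamW lamT K_c MelR T_l1)

/-! ## 1. The coupling profile as a degree-6 polynomial in the Legendre basis -/

/-- `gp = Σ_{p ≤ 6} ĝ_p P_p` (the row's coupling profile `g = −s + φ(x)` on `[-1, 1]`). -/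
def gp : ℝ[X] := ∑ p ∈ range (6 + 1), C (ghatR p) * legendre p

/-- `deg gp ≤ 6`. -/
theorem natDegree_gp_le : gp.natDegree ≤ 6 := by
  unfold gp
  refine natDegree_sum_le_of_forall_le _ _ (fun p hp => ?_)
  refine (natDegree_C_mul_le _ _).trans ?_
  rw [natDegree_legendre]
  rw [Finset.mem_range] at hp; omega

/-- The Legendre data of `gp` are the literal `ĝ`. -/
theorem legCoeff_gp (p : ℕ) : legCoeff gp p = if p ≤ 6 then ghatR p else 0 := by
  unfold gp; exact legCoeff_expansion 6 ghatR p

/-- pair weights with `ĉ(gp)` are those with the literal `ĝ` -/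
theorem pairWeight_gp (n m : ℕ) : pairWeight 6 (legCoeff gp) n m = pairWeight 6 ghatR n m := by
  unfold pairWeight
  refine sum_congr rfl fun p hp => ?_
  rw [legCoeff_gp, if_pos (by rw [Finset.mem_range] at hp; omega)]

/-- exact coupling with `ĉ(gp)` is the one with the literal `ĝ` -/
theorem couplingExact_gp (N : ℕ) (b e : ℕ → ℝ) : couplingExact N 6 (legCoeff gp) b e = couplingExact N 6 ghatR b e := by
  unfold couplingExact; simp_rw [pairWeight_gp]

/-- Hence the tracked finite part with `ĉ(gp)` is the one with the literal `ĝ`. -/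
theorem finGenW_gp (N : ℕ) (A B u v ε' T' : ℝ) (c a b d e : ℕ → ℝ) :
    finGenW N 6 A B u v ε' T' (legCoeff gp) c a b d e = finGenW N 6 A B u v ε' T' ghatR c a b d e := by
  unfold finGenW; rw [couplingExact_gp]

/-- `|g| ≤ T` on `[-1, 1]`: `Σ_{p≤6} |ĝ_p| = T` (the evaluator's `T_l1`, `ĝ₀ = −s`, `s > 0`) and `|P_p| ≤ 1` there (`Literature…LegendreNikolskii.abs_eval_legendre_le_one`). -/
theorem gp_abs_le : ∀ x ∈ Icc (-1 : ℝ) 1, |gp.eval x| ≤ ((T : ℚ) : ℝ) := by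
  have hsum : ((T : ℚ) : ℝ) = ∑ p ∈ range (6 + 1), |ghatR p| := by
    simp only [sum_range_succ, sum_range_zero, zero_add, ghatR]
    have hT : ((T : ℚ) : ℝ) = ((s : ℚ) : ℝ) + ((|ghat1| + |ghat2| + |ghat3| + |ghat4| + |ghat5| + |ghat6| : ℚ) : ℝ) := by
      rw [T_l1]; push_cast; ring
    have h0 : ((ghat0 : ℚ) : ℝ) = -((s : ℚ) : ℝ) := by
      rw [show ghat0 = -s from rfl]; push_cast; ring
    have hs : (0 : ℝ) < ((s : ℚ) : ℝ) := by norm_num [s]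
    rw [hT, h0, abs_neg, abs_of_pos hs]
    push_cast
    ring
  intro x hx
  have hx' : |x| ≤ 1 := abs_le.mpr ⟨by linarith [hx.1], hx.2⟩
  rw [hsum]
  unfold gp
  rw [eval_finsetSum]
  refine (Finset.abs_sum_le_sum_abs _ _).trans (Finset.sum_le_sum fun p _ => ?_)
  rw [eval_mul, eval_C, abs_mul]
  calc |ghatR p| * |(legendre p).eval x| ≤ |ghatR p| * 1 :=
        mul_le_mul_of_nonneg_left (abs_eval_legendre_le_one p hx') (abs_nonneg _)
    _ = |ghatR p| := mul_one _

/-! ## 2. Polynomial level: the certificate's element conditions ⇒ the RB-type form is `≥ 0` on two-sided polynomial pairs -/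

/-- **Positivity on two-sided polynomial test fields** from the element LMI `MelR ε (1/K) K ⪰ 0` and its two scalar slack lines
(rbsdp SPEC 3.5–3.7, `(N, P) = (16, 6)`, projected class). -/
theorem rbForm_poly_nonneg {K : ℝ} (hK : 0 < K) {ε : ℝ} (hε : 0 < ε) (hM : (MelR ε (1 / K) K).PosSemidef)
    (hW : 0 ≤ 16 * (1 / K) * (a0 : ℝ) - (T : ℝ) * ε * (lamW : ℝ)) (hT : 0 ≤ 4 * (s : ℝ) - (T : ℝ) * (lamT : ℝ) / ε)
    (Wp Θp : ℝ[X]) (h0 : Wp.eval (-1) = 0) (h1 : (derivative Wp).eval (-1) = 0) (h0' : Wp.eval 1 = 0) (h1' : (derivative Wp).eval 1 = 0)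
    (hΘ0 : Θp.eval (-1) = 0) (hΘ0' : Θp.eval 1 = 0) :
    0 ≤ rbForm ((a0 : ℚ) : ℝ) ((s : ℚ) : ℝ) (fun x => gp.eval x) K (fun x => Wp.eval x) (fun x => Θp.eval x) := by
  have hA0 : (0 : ℝ) ≤ ((a0 : ℚ) : ℝ) := by norm_num [a0, s, Ra]
  have hB0 : (0 : ℝ) ≤ ((s : ℚ) : ℝ) := by norm_num [s]
  have hlb := rbForm_poly_lower_bound 16 6 gp natDegree_gp_le (fun x => rfl) gp_abs_le hA0 hB0 hK hε Wp Θp h0 h1 hΘ0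
  rw [finGenW_gp] at hlb
  obtain ⟨hc0, hc1⟩ := legCoeff_farWall_W Wp h0 h1 h0' h1'
  have hd0 := legCoeff_farWall_Θ Θp hΘ0 hΘ0'
  set V1 := derivative Wp with hV1def
  set V2 := derivative V1 with hV2def
  set Θ1 := derivative Θp with hΘ1def
  set c := legCoeff V2 with hc
  set a := legCoeff V1 with ha
  set b := legCoeff Wp with hb
  set d := legCoeff Θ1 with hd
  set e := legCoeff Θp with he
  have hA : IsLadder c a := by rw [hc, ha, hV2def]; exact isLadder_legCoeff V1 h1
  have hB : IsLadder a b := by rw [ha, hb, hV1def]; exact isLadder_legCoeff Wp h0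
  have hE : IsLadder d e := by rw [hd, he, hΘ1def]; exact isLadder_legCoeff Θp hΘ0
  have ha0 : a 0 = c 0 - c 1 / 3 := by rw [ha, hc, hV2def]; exact legCoeff_zero_of_wall V1 h1
  have hb0 : b 0 = a 0 - a 1 / 3 := by rw [hb, ha, hV1def]; exact legCoeff_zero_of_wall Wp h0
  have he0 : e 0 = d 0 - d 1 / 3 := by rw [he, hd, hΘ1def]; exact legCoeff_zero_of_wall Θp hΘ0
  clear_value c a b d e
  have key := finGenW_eq_quadForm hA hB hE ha0 hb0 he0 hc0 hc1 hd0 ε (1 / K) K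
  have hq : 0 ≤ stack c d ⬝ᵥ (MelR ε (1 / K) K *ᵥ stack c d) := by
    have h := hM.dotProduct_mulVec_nonneg (stack c d)
    rwa [star_trivial] at h
  have hRc0 : 0 ≤ ∑ k ∈ range (max Wp.natDegree Θp.natDegree + 2), w (16 + 6 + 3 + k) * c (16 + 6 + 3 + k) ^ 2 :=
    sum_nonneg fun k _ => mul_nonneg (w_pos _).le (sq_nonneg _)
  have hRd0 : 0 ≤ ∑ k ∈ range (max Wp.natDegree Θp.natDegree + 2), w (16 + 6 + 2 + k) * d (16 + 6 + 2 + k) ^ 2 :=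
    sum_nonneg fun k _ => mul_nonneg (w_pos _).le (sq_nonneg _)
  have hlamW : ((lamW : ℚ) : ℝ) = lam (16 + 6) * lam (16 + 6 + 1) := by norm_num [lamW, lam]
  have hlamT : ((lamT : ℚ) : ℝ) = lam (16 + 6) := by norm_num [lamT, lam]
  have hW' : 0 ≤ (16 * (1 / K) * ((a0 : ℚ) : ℝ) - ((T : ℚ) : ℝ) * ε * (lam (16 + 6) * lam (16 + 6 + 1)))
      * ∑ k ∈ range (max Wp.natDegree Θp.natDegree + 2), w (16 + 6 + 3 + k) * c (16 + 6 + 3 + k) ^ 2 := by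
    rw [← hlamW]; exact mul_nonneg hW hRc0
  have hT' : 0 ≤ (4 * ((s : ℚ) : ℝ) - ((T : ℚ) : ℝ) * lam (16 + 6) / ε)
      * ∑ k ∈ range (max Wp.natDegree Θp.natDegree + 2), w (16 + 6 + 2 + k) * d (16 + 6 + 2 + k) ^ 2 := by
    rw [← hlamT]; exact mul_nonneg hT hRd0
  linarith [hlb, key, hq, hW', hT']

/-! ## 3. Density and the lattice: the RB-type form is `≥ 0` on the two-sided class at every certified lattice datum, and for every `K` beyond the cutoff -/

/-- **On the certified lattice modes `1 ≤ m ≤ 8`**: the form at `K = k_m² = (2π·m/2)²` is `≥ 0` on the whole two-sided `C² × C¹` class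
(lattice certificate + tail lemma + density). -/
theorem rbForm_nonneg_of_mode {m : ℕ} (hm : 1 ≤ m) (hm' : m ≤ 8) (W Θ : ℝ → ℝ) (hWΘ : TwoSidedX W Θ) :
    0 ≤ rbForm ((a0 : ℚ) : ℝ) ((s : ℚ) : ℝ) (fun x => gp.eval x) ((2 * Real.pi * (m : ℝ) / (2 : ℝ)) ^ 2) W Θ := by
  have hm0 : (0 : ℝ) < (m : ℝ) := by exact_mod_cast hm
  have hK : (0 : ℝ) < (2 * Real.pi * (m : ℝ) / (2 : ℝ)) ^ 2 := by positivity
  obtain ⟨ε, hε, hM, hW, hT⟩ := Certs.N1G2.Evaluator.certificate m hm hm'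
  exact RBDensity.rbForm_nonneg_of_poly2 (Polynomial.continuous gp)
    (fun Wp Θp h0 h1 h0' h1' hΘ0 hΘ0' => rbForm_poly_nonneg hK hε hM hW hT Wp Θp h0 h1 h0' h1' hΘ0 hΘ0') hWΘ

/-- **Beyond the cutoff**: for every `K ≥ K_c` the form is `≥ 0` for ALL `W, Θ` (no wall condition needed; `T² ≤ a0·s·K_c²` = the evaluator's `cutoff`,
rbsdp SPEC 3.8 D1; pointwise AM–GM, `TailTwoSided.rbForm_nonneg_of_cutoff`). -/
theorem rbForm_nonneg_beyond_cutoff {K : ℝ} (hK : ((K_c : ℚ) : ℝ) ≤ K) (W Θ : ℝ → ℝ) :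
    0 ≤ rbForm ((a0 : ℚ) : ℝ) ((s : ℚ) : ℝ) (fun x => gp.eval x) K W Θ := by
  have hA0 : (0 : ℝ) ≤ ((a0 : ℚ) : ℝ) := by norm_num [a0, s, Ra]
  have hB0 : (0 : ℝ) ≤ ((s : ℚ) : ℝ) := by norm_num [s]
  have hKc : (0 : ℝ) < ((K_c : ℚ) : ℝ) := by norm_num [K_c]
  have hcut : ((T : ℚ) : ℝ) ^ 2 ≤ ((a0 : ℚ) : ℝ) * ((s : ℚ) : ℝ) * ((K_c : ℚ) : ℝ) ^ 2 := by
    exact_mod_cast Certs.N1G2.Evaluator.cutoff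
  have hg : ∀ x ∈ Icc (-1 : ℝ) 1, |(fun x : ℝ => gp.eval x) x| ≤ ((T : ℚ) : ℝ) := fun x hx => gp_abs_le x hx
  exact rbForm_nonneg_of_cutoff hA0 hB0 hKc hg hcut hK W Θ

end Summit.NavierStokesRegularity.TurbBounds.TailN1G2

end
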